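import Summits.Ventures.ResidMod.VerdictsFull
import Summits.Ventures.ResidMod.InstanceKit
import HarnessLib

/-!
# Venture ResidMod — census row, flag T-L: the Jacobian of the genus-2 curve 353.a.353.1 is modular,
# GIVEN Boxer–Calegari–Gee–Pilloni 2025 Thm. 1.1.1 and the cell's certificate for this curve

HONEST FRAMING. A per-surface INSTANCE of the cell's full-chain mod-3 verdict (`modular_of_mod3Row`),
NOT an unconditional proof: "BCGP 2025 Thm. 1.1.1 (`h111`) ∧ Deligne's ordinarity criterion (`hDel`) — both named
facts of the tree — ∧ the certificate data below ⟹ `A` modular (almost-everywhere `GL₄` form)", every datum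
about `A` a binder. The curve
(LMFDB `353.a.353.1`, conductor `353`, prime):

  `X : y² + (x³ + x + 1) y = x²`.

This curve's Jacobian was proved paramodular by Brumer–Pacetti–Poor–Tornaría–Voight–Yuen (ANT 2019;
tree: `Literature/NumberTheory/FaltingsSerre/Paramodular353*.lean`) and it satisfies the hypotheses of
BCGP 2025 Thm. 1.1.1 (it is one of the `11384` LMFDB curves of loc. cit. §10.1), so NOTHING NEW is
claimed: this file is the cell's CONTROL instance of the T-L chain. `A` stands for `Jac(X)` through the
binders: `ρb`/`hframe` (`ρb` is `ρ̄_{A,3}`, TORS3), `hsurj` (image `GSp₄(𝔽₃)`: LMFDB `non_maximal_primes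
= [2, 11]`; the cell's offline checker), `hunr` (`ρ̄_{A,3}` unramified at `2`: good reduction, `353` odd),
`hgood₃` (good reduction at `3`: `353` is prime; the tree's scheme-theoretic `HasGoodReductionAt`, a binder — ordinarity itself is DERIVED here from `3 ∤ b₃ = 4` by `hDel`), and the two Euler factors (engines' exact
point counts: engine-2 census pass 1, `engine/eng2/out/census_pass1/summary_pass1_B256.tsv` row `353.a.353.1`: `L_2 = [1,1,3,2,4]`, `L_3 = [1,2,4,6,9]`, `ordinary_at_3 = true`, `mod3_surjective_certified = 1`; the seat's stdlib screen `work/tl_screen.py` and the paramodular cell's `(a₃,b₃)(f₃₅₃) = (−2,4)` (`Paramodular353CitedOfCard.lean`) agree):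
  `L₂(A,T) = 1 + T + 3T² + 2T³ + 4T⁴`   (`(a₂,b₂) = (−1,3)`; `b₂ ≡ 0 mod 3` ⟹ F2OK, decided here),
  `L₃(A,T) = 1 + 2T + 4T² + 6T³ + 9T⁴`  (`(a₃,b₃) = (−2,4)`; separable: Bézout identity
      `(146 − 288T − 72T²)·L₃ + (5 − 22T + 75T² + 18T³)·L₃' = 156`, checked here by `ring` ⟹ DIST0(3)).

References: [BoxerCalegariGeePilloni2025] arXiv:2502.20645 Thm. 1.1.1, §10.1; [BrumerEtAl2019] Thm.
7.1.3 (`N = 353`); [LMFDB] genus-2 curve 353.a.353.1; cell HOME `run/shared/lean/pub/pub-residmod/`.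
-/

noncomputable section

namespace Summit.Ventures.ResidMod.Instances

open CategoryTheory IsDedekindDomain Field Polynomial Matrix
open scoped NumberField
open Literature.NumberTheory.GaloisRepresentations Literature.NumberTheory.Automorphic
open Literature.NumberTheory.Automorphic.Paramodular
open Literature.NumberTheory.DiophantineGeometry Literature.NumberTheory.FaltingsSerre
open Literature.AlgebraicGeometry.Motives (AbelianVariety HasGoodReductionAt)
open Summit.Ventures.ResidMod

/-- DIST0(3) for 353.a: `L₃ = 1 + 2T + 4T² + 6T³ + 9T⁴` is separable over `ℚ` (Bézout pair with
`N = 156`, checked by `ring`). [cite: BoxerCalegariGeePilloni2025, Def. 9.1.2] -/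
theorem separable_L3_353a : ((lPolynomialOfSurface 3 (-2) 4).map (Int.castRingHom ℚ)).Separable := by
  apply separable_of_intBezout (U := 146 - 288 * X - 72 * X ^ 2) (V := 5 - 22 * X + 75 * X ^ 2 + 18 * X ^ 3)
    (N := 156) (by norm_num)
  rw [derivative_map_lPolynomialOfSurface_eq, map_lPolynomialOfSurface_eq]
  push_cast
  ring

/-- **Census row 353.a.353.1 (flag T-L, CONTROL): modular GIVEN Thm. 1.1.1 and the certificate.**
Binders: `h111`; `A`, `hA`; `ρb`, `hframe` (TORS3); `hsurj` (POL ∧ SURJ(3)); `hunr` (UNRAM2);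
`hL2 : L₂ = 1 + T + 3T² + 2T³ + 4T⁴`; `hL3 : L₃ = 1 + 2T + 4T² + 6T³ + 9T⁴`; `hgood₃` (GOOD(3)); `hDel`. Decided in
the kernel: F2OK (`b₂ = 3 ≡ 0 mod 3`), ORD(3) (`3 ∤ 4`, via `hDel`) and DIST0(3) (`separable_L3_353a`). Conclusion: every framed dual of
every `V_p(A)` is `IsAutomorphicAE`. [cite: BoxerCalegariGeePilloni2025, Thm. 1.1.1 and §10.1] -/
theorem modular_353a (h111 : bcgp2025_modThreeSurjective_modular_abelianSurface)
    (hDel : deligne_hasGoodOrdinaryReductionAt_iff_not_dvd_middleCoeff)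
    (A : AbelianVariety ℚ) (hA : A.dim = 2) (ρb : FramedGaloisRep ℚ (ZMod 3) 4)
    (hframe : ∃ e₃ : A.geomTorsion (3 : ℕ) ≃+ (Fin 4 → ZMod 3),
      ∀ (g : absoluteGaloisGroup ℚ) (P : A.geomTorsion (3 : ℕ)),
        e₃ (g • P) = ((ρb g⁻¹ : GL (Fin 4) (ZMod 3)) : Matrix (Fin 4) (Fin 4) (ZMod 3))ᵀ *ᵥ e₃ P)
    (hsurj : ∃ J : Matrix (Fin 4) (Fin 4) (ZMod 3), Jᵀ = -J ∧ IsUnit J.det ∧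
      (∀ σ : absoluteGaloisGroup ℚ,
        (ρb σ).valᵀ * J * (ρb σ).val =
          (((modPCyclotomicCharacterZMod ℚ 3 σ)⁻¹ : (ZMod 3)ˣ) : ZMod 3) • J) ∧
      ∀ M : Matrix (Fin 4) (Fin 4) (ZMod 3),
        (∃ c : (ZMod 3)ˣ, Mᵀ * J * M = (c : ZMod 3) • J) →
          ∃ σ : absoluteGaloisGroup ℚ, (ρb σ).val = M)
    (hunr : ∀ v : HeightOneSpectrum (𝓞 ℚ), ((2 : ℕ) : 𝓞 ℚ) ∈ v.asIdeal → ρb.IsUnramifiedAt v)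
    (hL2 : A.HasGoodEulerFactorAt 2 ((lPolynomialOfSurface 2 (-1) 3).map (Int.castRingHom ℚ)))
    (hL3 : A.HasGoodEulerFactorAt 3 ((lPolynomialOfSurface 3 (-2) 4).map (Int.castRingHom ℚ)))
    (hgood₃ : ∀ v : HeightOneSpectrum (𝓞 ℚ), ((3 : ℕ) : 𝓞 ℚ) ∈ v.asIdeal → HasGoodReductionAt A.X A.dim v) :
    ∀ (p : ℕ) [Fact p.Prime] (b : Module.Basis (Fin 4) ℚ_[p] (A.rationalTateModule p))
      (r : FramedGaloisRep ℚ (PadicAlgCl p) 4),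
      (∀ g : absoluteGaloisGroup ℚ,
        (r g).val =
          ((LinearMap.toMatrix b b (A.rationalTateRep p g⁻¹)).map
            (algebraMap ℚ_[p] (PadicAlgCl p))).transpose) →
      ∀ (hcpt : isCompact_glFiniteIntegralLevel 4 ℚ) (ι : PadicAlgCl p ≃+* ℂ),
        IsAutomorphicAE ι hcpt r :=
  modular_of_mod3Row h111 hDel A hA ρb hframe hsurj hunr hL2 (by decide) hL3 (by decide)
    separable_L3_353a hgood₃

end Summit.Ventures.ResidMod.Instances

end
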